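import Literature.Computability.Complexity.FourierDegree
import Literature.Computability.Complexity.PeresNoiseSensitivity
import HarnessLib

/-!
# Crux `MobiusLadder.LiouvilleOrthogonalTC0` (stmt-QuantumAdvantage-1393), line `Sketch`, skeleton v10:
stub `stub_ptfBlock` (P2) — block sensitivity of degree-`d` polynomial threshold functions

The PTF rung of the line bounds the number of pairs (point, pivotal coordinate) of every degree-`≤ d`
polynomial threshold function `[0 ≤ q]` on every cube `Fin m → Bool` by `2 m^{1−1/2^d} 2^m`
(Diakonikolas–Raghavendra–Servedio–Tan, the neighbour stub `stub_drstAS`, here the hypothesis `hAS`).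
This file transfers that bound to BLOCK sensitivity: for a real `p` on `Fin n → Bool` of Fourier
degree `≤ d` and a block labelling `π : Fin n → Fin m`, the number of pairs (point `x`, block `j`)
with `[0 ≤ p x] ≠ [0 ≤ p (x with the bits of block π⁻¹(j) flipped)]` is at most `2 m^{1−1/2^d} 2ⁿ`.

Proof (O'Donnell 2014, Thm. 5.35, the reparametrisation of the tree's
`sum_card_blockFlip_le_of_unate`). Write `mix ω x₀ = x₀ ⊕ ω∘π` (bit `i` of `x₀` negated iff
`ω (π i)`). For each `ω` the map `x₀ ↦ mix ω x₀` is an involution of the big cube, so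
`2^m Σ_x X x = Σ_{x₀} Σ_ω X (mix ω x₀)`; flipping block `j` of `mix ω x₀` is flipping bit `j` of
`ω`, so the fibre sum `Σ_ω X (mix ω x₀)` is the pivotal count of the fibre function
`ω ↦ p (mix ω x₀)` on `Fin m → Bool`, to which `hAS` applies once we know its degree is `≤ d`
(`StubPtfBlock.fourierDegree_mix_le`): `χ_T(mix ω x₀) = χ_T(x₀) · χ_{U T}(ω)` with
`U T = {j : #(T ∩ π⁻¹ j) odd}` (`walsh_mix`; written out as a `Finset.filter`, no definition),
`|U T| ≤ |T|` (`card_oddFibres_le`), hence by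
inversion and orthogonality the coefficient of the fibre function at `S` is
`Σ_{T : U T = S} p̂(T) χ_T(x₀)` (`cubeFourierCoeff_mix`), which vanishes when `|S| > deg p`.

* `StubPtfBlock.sum_card_blockFlip_le_of_fibre` — the reparametrisation with a generic fibre bound;
* `StubPtfBlock.fourierDegree_mix_le` — the fibre functions of a degree-`d` function have degree `≤ d`;
* `stub_ptfBlock` — the registered stub (verbatim signature).
-/

set_option linter.dupNamespace false -- D-0017: single-problem summit ⇒ `QuantumAdvantage.QuantumAdvantage` by design

noncomputable section

namespace Summit.QuantumAdvantage.QuantumAdvantage.Theorems.LiouvilleOrthogonalTC0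

open Finset
open Literature.Computability.Complexity Literature.Computability.Complexity.LowDegree
open Literature.Probability.RandomGraphs.LowDegree (sgn walsh)

namespace StubPtfBlock

open Literature.Probability.RandomGraphs.LowDegree (sgn_true sgn_false)

variable {n m : ℕ}

/-! ### Characters at the reparametrised point `x₀ ⊕ ω∘π` -/

/-- `sgn` of a conditionally negated bit: `sgn (if b then ¬c else c) = sgn c · sgn b`. -/
theorem sgn_ite_not (b c : Bool) : sgn (if b then !c else c) = sgn c * sgn b := by
  cases b <;> cases c <;> norm_num [sgn]

/-- Powers of a sign: `sgn b ^ k = 1` for even `k`, `= sgn b` for odd `k`. -/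
theorem sgn_pow (b : Bool) (k : ℕ) : sgn b ^ k = if Even k then 1 else sgn b := by
  cases b
  · simp
  · rw [sgn_true]
    rcases Nat.even_or_odd k with h | h
    · rw [if_pos h, h.neg_one_pow]
    · rw [if_neg (Nat.not_even_iff_odd.mpr h), h.neg_one_pow]

/-- The set `U T = {j : #(T ∩ π⁻¹ j) odd}` of blocks met an odd number of times by `T` (written out
as `univ.filter fun j => Odd (T.filter fun i => π i = j).card` throughout; no definition is
introduced) has `|U T| ≤ |T|`, since `U T ⊆ π(T)`. -/
theorem card_oddFibres_le (π : Fin n → Fin m) (T : Finset (Fin n)) :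
    (univ.filter fun j : Fin m => Odd (T.filter fun i => π i = j).card).card ≤ T.card := by
  refine le_trans (Finset.card_le_card (t := T.image π) fun j hj => ?_) Finset.card_image_le
  simp only [mem_filter, mem_univ, true_and] at hj
  obtain ⟨i, hi⟩ := Finset.card_pos.mp hj.pos
  rw [mem_filter] at hi
  exact mem_image.mpr ⟨i, hi.1, hi.2⟩

/-- **Characters factor through the reparametrisation**:
`χ_T(x₀ ⊕ ω∘π) = χ_T(x₀) · χ_{U T}(ω)`. -/
theorem walsh_mix (π : Fin n → Fin m) (T : Finset (Fin n)) (x₀ : Fin n → Bool)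
    (ω : Fin m → Bool) :
    walsh T (fun i => if ω (π i) then !x₀ i else x₀ i) =
      walsh T x₀ * walsh (univ.filter fun j : Fin m => Odd (T.filter fun i => π i = j).card) ω := by
  unfold walsh
  simp only [sgn_ite_not]
  rw [prod_mul_distrib]
  congr 1
  rw [← prod_fiberwise' T π (fun j => sgn (ω j))]
  simp only [prod_const, sgn_pow]
  rw [prod_filter]
  refine prod_congr rfl fun j _ => ?_
  split_ifs with h1 h2 h2
  · exact absurd h1 (Nat.not_even_iff_odd.mpr h2)
  · rfl
  · rfl
  · exact absurd (Nat.not_even_iff_odd.mp h1) h2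

/-- **Fourier coefficients of the fibre function** `ω ↦ p (x₀ ⊕ ω∘π)`: the coefficient at `S` is
`Σ_{T : U T = S} p̂(T) χ_T(x₀)` (inversion for `p`, `walsh_mix`, orthogonality in `ω`). -/
theorem cubeFourierCoeff_mix (p : (Fin n → Bool) → ℝ) (π : Fin n → Fin m) (x₀ : Fin n → Bool)
    (S : Finset (Fin m)) :
    cubeFourierCoeff (fun ω : Fin m → Bool => p fun i => if ω (π i) then !x₀ i else x₀ i) S =
      ∑ T : Finset (Fin n),
        if (univ.filter fun j : Fin m => Odd (T.filter fun i => π i = j).card) = S then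
          cubeFourierCoeff p T * walsh T x₀ else 0 := by
  rw [cubeFourierCoeff]
  have step : ∑ ω : Fin m → Bool, p (fun i => if ω (π i) then !x₀ i else x₀ i) * walsh S ω =
      ∑ ω : Fin m → Bool, ∑ T : Finset (Fin n),
        cubeFourierCoeff p T * walsh T x₀ *
          (walsh (univ.filter fun j : Fin m => Odd (T.filter fun i => π i = j).card) ω *
            walsh S ω) := by
    refine Finset.sum_congr rfl fun ω _ => ?_
    rw [← sum_cubeFourierCoeff_mul_walsh p (fun i => if ω (π i) then !x₀ i else x₀ i),
      Finset.sum_mul]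
    refine Finset.sum_congr rfl fun T _ => ?_
    rw [walsh_mix]
    ring
  rw [step, Finset.sum_comm, Finset.sum_div]
  refine Finset.sum_congr rfl fun T _ => ?_
  rw [← Finset.mul_sum, sum_walsh_mul_walsh_index]
  have h2 : (2 : ℝ) ^ m ≠ 0 := by positivity
  split_ifs
  · field_simp
  · simp

/-- **The fibre functions of a degree-`d` function have degree `≤ d`**:
`deg (ω ↦ p (x₀ ⊕ ω∘π)) ≤ deg p` — a coefficient at `S` with `|S| > deg p` is a sum over `T` with
`U T = S`, hence `|T| ≥ |S| > deg p` and `p̂(T) = 0`. -/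
theorem fourierDegree_mix_le (p : (Fin n → Bool) → ℝ) (π : Fin n → Fin m) (x₀ : Fin n → Bool) :
    fourierDegree (fun ω : Fin m → Bool => p fun i => if ω (π i) then !x₀ i else x₀ i) ≤
      fourierDegree p := by
  refine Finset.sup_le fun S hS => ?_
  have hSc : cubeFourierCoeff
      (fun ω : Fin m → Bool => p fun i => if ω (π i) then !x₀ i else x₀ i) S ≠ 0 := by
    simpa using hS
  refine le_of_not_gt fun hlt => hSc ?_
  rw [cubeFourierCoeff_mix]
  refine Finset.sum_eq_zero fun T _ => ?_
  split_ifs with h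
  · have hST : S.card ≤ T.card := by rw [← h]; exact card_oddFibres_le π T
    rw [cubeFourierCoeff_eq_zero_of_lt (lt_of_lt_of_le hlt hST), zero_mul]
  · rfl

/-! ### The block reparametrisation (O'Donnell 2014, Thm. 5.35) with a generic fibre bound -/

/-- **Block flips via the `2^m`-fold cover `x = x₀ ⊕ ω∘π`.** If for every base point `x₀` the fibre
function `ω ↦ h (x₀ ⊕ ω∘π)` on `Fin m → Bool` has at most `B · 2^m` pairs (point, pivotal bit), then
`h` has at most `B · 2ⁿ` pairs (point, pivotal block): flipping block `j` of `x₀ ⊕ ω∘π` is flipping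
bit `j` of `ω` (same argument as the tree's `sum_card_blockFlip_le_of_unate`). -/
theorem sum_card_blockFlip_le_of_fibre (h : (Fin n → Bool) → Bool) (π : Fin n → Fin m) (B : ℝ)
    (hfib : ∀ x₀ : Fin n → Bool,
      ∑ ω : Fin m → Bool, ((univ.filter fun j : Fin m =>
          h (fun i => if ω (π i) then !x₀ i else x₀ i) ≠
            h (fun i => if Function.update ω j (!ω j) (π i) then !x₀ i else x₀ i)).card : ℝ)
        ≤ B * (2 : ℝ) ^ m) :
    ∑ x : Fin n → Bool, ((univ.filter fun j : Fin m =>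
        h x ≠ h (fun i => xor (x i) (decide (π i = j)))).card : ℝ)
      ≤ B * (2 : ℝ) ^ n := by
  set X : (Fin n → Bool) → ℝ := fun x =>
    ((univ.filter fun j : Fin m => h x ≠ h (fun i => xor (x i) (decide (π i = j)))).card : ℝ)
    with hX
  -- the block reparametrisation `mix ω x₀ = x₀ ⊕ ω ∘ π`
  set mix : (Fin m → Bool) → (Fin n → Bool) → (Fin n → Bool) :=
    fun ω x₀ i => if ω (π i) then !x₀ i else x₀ i with hmix
  have hmix_invol : ∀ ω, Function.Involutive (mix ω) := by
    intro ω x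
    funext i
    simp only [hmix]
    cases ω (π i) <;> simp
  -- flipping block `j` of `mix ω x₀` is flipping bit `j` of `ω`
  have hflip : ∀ ω x₀ j, (fun i => xor (mix ω x₀ i) (decide (π i = j))) =
      mix (Function.update ω j (!ω j)) x₀ := by
    intro ω x₀ j
    funext i
    simp only [hmix]
    by_cases hP : π i = j
    · rw [hP, Function.update_self]
      cases x₀ i <;> cases ω j <;> simp
    · rw [Function.update_of_ne hP]
      simp [hP]
  -- each fibre is the pivotal count of the fibre function on `Fin m → Bool`
  have hfib' : ∀ x₀ : Fin n → Bool, ∑ ω : Fin m → Bool, X (mix ω x₀) ≤ B * (2 : ℝ) ^ m := by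
    intro x₀
    have h1 : ∑ ω : Fin m → Bool, ((univ.filter fun j : Fin m =>
        h (mix ω x₀) ≠ h (mix (Function.update ω j (!ω j)) x₀)).card : ℝ) ≤ B * (2 : ℝ) ^ m :=
      hfib x₀
    refine le_of_eq_of_le (sum_congr rfl fun ω _ => ?_) h1
    simp only [hX, hflip]
  -- `2^m Σ_x X x = Σ_{x₀} Σ_ω X (mix ω x₀)`
  have hcover : ∀ ω : Fin m → Bool, ∑ x, X x = ∑ x₀, X (mix ω x₀) := fun ω =>
    (Fintype.sum_equiv (hmix_invol ω).toPerm (fun x₀ => X (mix ω x₀)) X fun _ => rfl).symm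
  have hsum : (2 : ℝ) ^ m * ∑ x, X x = ∑ x₀ : Fin n → Bool, ∑ ω : Fin m → Bool, X (mix ω x₀) := by
    rw [sum_comm]
    simp only [← hcover, sum_const, card_univ, Fintype.card_fun, Fintype.card_bool,
      Fintype.card_fin, nsmul_eq_mul]
    push_cast
    ring
  have h2 : (0 : ℝ) < (2 : ℝ) ^ m := by positivity
  have key : (2 : ℝ) ^ m * ∑ x, X x ≤ (2 : ℝ) ^ m * (B * (2 : ℝ) ^ n) := by
    rw [hsum]
    calc ∑ x₀ : Fin n → Bool, ∑ ω : Fin m → Bool, X (mix ω x₀)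
        ≤ ∑ _x₀ : Fin n → Bool, B * (2 : ℝ) ^ m := sum_le_sum fun x₀ _ => hfib' x₀
      _ = (2 : ℝ) ^ m * (B * (2 : ℝ) ^ n) := by
          rw [sum_const, card_univ, Fintype.card_fun, Fintype.card_bool, Fintype.card_fin,
            nsmul_eq_mul]
          push_cast
          ring
  exact le_of_mul_le_mul_left key h2

end StubPtfBlock

/-- **Stub P2 (wave 3, v10) — block sensitivity of degree-`d` PTFs.** From the average-sensitivity
bound `hAS` (`stub_drstAS`): for every real `p` on `Fin n → Bool` of degree `≤ d` and every block
labelling `π : Fin n → Fin m`, `Σ_x #{j : [0 ≤ p x] ≠ [0 ≤ p (x with block π⁻¹(j) flipped)]} ≤ 2 m^{1−1/2^d} 2ⁿ`: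
reparametrise `x = x₀ ⊕ ω∘π` (a `2^m`-fold cover of the cube; flipping block `j` of `x` is flipping bit
`j` of `ω`, `StubPtfBlock.sum_card_blockFlip_le_of_fibre`), and observe that the fibre function
`ω ↦ p(x₀ ⊕ ω∘π)` has degree `≤ d` (`StubPtfBlock.fourierDegree_mix_le`). -/
theorem stub_ptfBlock
    (hAS : ∀ (m d : ℕ) (q : (Fin m → Bool) → ℝ), fourierDegree q ≤ d →
      ∑ ω : Fin m → Bool, ((Finset.univ.filter fun i : Fin m =>
          decide (0 ≤ q ω) ≠ decide (0 ≤ q (Function.update ω i (!ω i)))).card : ℝ)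
        ≤ 2 * (m : ℝ) ^ ((1 : ℝ) - 1 / 2 ^ d) * (2 : ℝ) ^ m)
    {n m d : ℕ} (p : (Fin n → Bool) → ℝ) (hp : fourierDegree p ≤ d) (π : Fin n → Fin m) :
    ∑ x : Fin n → Bool, ((Finset.univ.filter fun j : Fin m =>
        decide (0 ≤ p x) ≠ decide (0 ≤ p (fun i => xor (x i) (decide (π i = j))))).card : ℝ)
      ≤ 2 * (m : ℝ) ^ ((1 : ℝ) - 1 / 2 ^ d) * (2 : ℝ) ^ n := by
  exact StubPtfBlock.sum_card_blockFlip_le_of_fibre (fun x => decide (0 ≤ p x)) π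
    (2 * (m : ℝ) ^ ((1 : ℝ) - 1 / 2 ^ d)) fun x₀ =>
      hAS m d (fun ω => p fun i => if ω (π i) then !x₀ i else x₀ i)
        ((StubPtfBlock.fourierDegree_mix_le p π x₀).trans hp)

end Summit.QuantumAdvantage.QuantumAdvantage.Theorems.LiouvilleOrthogonalTC0

end
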